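import Literature.NumberTheory.Automorphic.UnitaryGroupNonsplitPlace
import Literature.NumberTheory.Automorphic.UnitaryGroupBorelInduction
import Literature.NumberTheory.Automorphic.UnitaryGroupAdelicOneTorusDictionary
import Literature.NumberTheory.Automorphic.HeckeCharacterLocalComponentSmooth
import Literature.NumberTheory.GaloisRepresentations.IdelicLocalNorm
import Literature.NumberTheory.GaloisRepresentations.HeckeCharacterProofs
import HarnessLib

/-!
# Local components of characters of the norm-one torus `T = U(1)_{E/F}` and of Hecke characters, over the
# semi-local ring `E ⊗_F F_v = ∏_{w ∣ v} E_w` (typing item «T-loc» of the CM local A-packet vocabulary)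

For a quadratic extension of number fields `E/F` with non-trivial automorphism `c`, a finite place `v` of `F`, and the
tree's carriers
* `UnitaryGroup.LocalRing E v = ∏_{w ∣ v} E_w` with its conjugation `UnitaryGroup.conjLocal E c v = c ⊗ 1`
  (`UnitaryGroupAutomorphicRep`), and `UnitaryGroup.normOneUnits (conjLocal E c v) = T(F_v) = {x : c(x) x = 1}`
  (`UnitaryGroupBorelInduction`; the type of the labels `η₁ η₂` of ★ `cmXiTorusChar` ∕ `Rogawski1990.KeysCaseTwoLabels`),
* `TorusDict.torus c = T(𝔸_F) = {x ∈ 𝕀_E : x · (c • x) = 1}` (`Arthur2013/Leaves/TorusDictionary`, §45; automorphic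
  characters `ψ : T(𝔸_F) →ₜ* ℂˣ`, `TorusDict.IsAutomorphic`, and their base change `TorusDict.pullback ψ = ψ ∘ (z ↦ c • z / z)`,
  a `HeckeCharacter E`),
this module supplies the LOCAL COMPONENTS at `v` in BOTH currencies and the dictionary between them:

* §1 `UnitaryGroup.semilocalUnits E v : (∏_{w ∣ v} E_w)ˣ →* 𝕀_E` — the block inclusion `u ↦ (…, 1, (u_w)_{w ∣ v}, 1, …)`
  (product of the tree's single-place inclusions ★ `localUnits w`), its components, injectivity, continuity, and
  `Gal(E/F)`-EQUIVARIANCE `σ • semilocalUnits u = semilocalUnits ((σ ⊗ 1) u)` (`smul_semilocalUnits`);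
* §2 `HeckeCharacter.semilocalComponent χ v := χ ∘ semilocalUnits v : (∏_{w ∣ v} E_w)ˣ →* ℂˣ` — the semi-local component of a
  Hecke character (the `μ`-slot `(LocalRing L v)ˣ →* ℂˣ` of ★ `cmXiTorusChar`), `= ∏_{w ∣ v} χ_w (u_w)` (`semilocalComponent_eq_prod`),
  and at a NON-SPLIT `v` (`c • w = w`, one place above `v`) `= χ_w (u_w)` (`semilocalComponent_eq_localComponent_of_smul_eq`:
  the one-factor reading);
* §3 `UnitaryGroup.locTorusIncl E c v : T(F_v) →* T(𝔸_F)` — the restriction of §1 to norm-one units (it lands in the torus by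
  equivariance, at EVERY `v`, split or not), continuity, injectivity; at a non-split `v` its image lies in the level subgroup
  `T(𝒪_v) = T(𝔸_F) ∩ ∏_{w ∣ v} 𝒪_w^×` (`locTorusIncl_mem_localUnitIdeles_of_smul_eq`, from ★ `TorusDict.mem_localUnitIdeles_of_mem_torus`:
  the local torus at a non-split place is compact);
* §4 `UnitaryGroup.torusLocalComponent ψ v := ψ ∘ locTorusIncl v : T(F_v) →* ℂˣ` — THE LOCAL COMPONENT `ξ_v` of a character `ξ = ψ` of
  `T(𝔸_F)` (the `η₁ ∕ η₂` slots of ★ `cmXiTorusChar` ∕ `KeysCaseTwoLabels`), continuity, unitarity for automorphic `ψ`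
  (★ `norm_torusHom_apply_eq_one_of_isAutomorphic`), and `ξ_v = 1` when `ψ` is spherical at a non-split `v`;
* §5 THE LOCAL DICTIONARY: `(TorusDict.pullback ψ).semilocalComponent v u = ψ (locTorusIncl ((c u) / u))`
  (`pullback_semilocalComponent`; in the CM case through ★ `quotConj`: `χ̃_v (a) = ξ_v (a / ā)⁻¹`,
  `cm_pullback_semilocalComponent`), and the SPLIT-PLACE CONVENTION LEMMA asked for by the D6 design (junk point (J6)):
  `χ̃_{c • w} (c_w a) = χ̃_w (a)⁻¹` for the base change `χ̃` of any automorphic `ψ` (`pullback_localComponent_smul`; from ★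
  `algEquiv_smul_localUnits` and ★ `TorusDict.pullback_smul`) — the two places `w`, `c • w` above a split `v` carry mutually
  inverse-conjugate local components, so a packet family pinned at ONE `w ∣ v` is pinned.

Everything is DATA with bodies and PROVED lemmas: no `def … : Prop`, no named fact, no `sorry`, no instance, no notation.
The archimedean components (∞-types) are ★ `TorusDict.hasUnitaryArchType_pullback_iff` (§45.7) and are not repeated here.

References: [Rogawski1990] J. Rogawski, *Automorphic Representations of Unitary Groups in Three Variables* (1990), §12.1
p. 172 (`χ̃(a) = χ(a/ā)`), §12.2 pp. 173–174 (`ξ_v`, `i_G(ξ_w)` at split `v`); [CasselsFrohlichANT1967] Ch. II §10–§11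
(`E ⊗_F F_v = ∏_{w ∣ v} E_w`), Ch. VII §1.1 (Galois transport of completions); [TateThesis1967] §3.2, §4.3 (local components
of idele class characters); [PlatonovRapinchuk1994] §6.2 (the norm-one torus).
-/

set_option autoImplicit false

noncomputable section

open NumberField IsDedekindDomain
open Literature.NumberTheory.GaloisRepresentations
open Literature.NumberTheory.Automorphic.Arthur2013.Leaves.TECR

namespace Literature.NumberTheory.Automorphic

namespace UnitaryGroup

section Quadratic

variable {F : Type} (E : Type) [Field F] [NumberField F] [Field E] [NumberField E] [Algebra F E]
  (c : E ≃ₐ[F] E) {v : HeightOneSpectrum (𝓞 F)}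

/-! ## §1 The block inclusion `(∏_{w ∣ v} E_w)ˣ →* 𝕀_E` -/

variable (v) in
/-- **The semi-local units inclusion `(E ⊗_F F_v)ˣ = ∏_{w ∣ v} E_wˣ → 𝕀_E`** at the finite place `v` of `F`: `u ↦` the idele
with component `u_w` at each place `w ∣ v` of `E` and `1` at every other (finite or infinite) place — the product over
`w ∣ v` of the tree's single-place inclusions ★ `localUnits w`. [cite: TateThesis1967, §3.2] -/
def semilocalUnits : (LocalRing E v)ˣ →* ideleGroup E where
  toFun u := ∏ w : PlacesOver E v, localUnits w.1 (MulEquiv.piUnits u w)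
  map_one' := by simp
  map_mul' u u' := by simp [Finset.prod_mul_distrib]

/-- Unfolding `semilocalUnits`. [cite: TateThesis1967, §3.2] -/
theorem semilocalUnits_apply (u : (LocalRing E v)ˣ) :
    semilocalUnits E v u = ∏ w : PlacesOver E v, localUnits w.1 (MulEquiv.piUnits u w) := rfl

/-- `semilocalUnits v u` is `1` at the infinite places. [cite: TateThesis1967, §3.2] -/
@[simp] theorem semilocalUnits_fst (u : (LocalRing E v)ˣ) :
    ((semilocalUnits E v u : ideleGroup E) : AdeleRing (𝓞 E) E).1 = 1 := by
  rw [← ideleGroup.infComp_apply, semilocalUnits_apply, map_prod]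
  exact Finset.prod_eq_one fun w _ => by rw [ideleGroup.infComp_apply, localUnits_fst]

/-- `semilocalUnits v u` has component `u_w` at a place `w ∣ v`. [cite: TateThesis1967, §3.2] -/
@[simp] theorem semilocalUnits_snd_apply_of_over (u : (LocalRing E v)ˣ) (w : PlacesOver E v) :
    ((semilocalUnits E v u : ideleGroup E) : AdeleRing (𝓞 E) E).2 w.1 = (u : LocalRing E v) w := by
  rw [← ideleGroup.finComp_apply, semilocalUnits_apply, map_prod,
    Finset.prod_eq_single_of_mem w (Finset.mem_univ w) fun w' _ hw' => ?_]
  · rw [ideleGroup.finComp_apply, localUnits_snd_apply_self]; rfl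
  · rw [ideleGroup.finComp_apply]
    exact localUnits_snd_apply_of_ne _ fun h => hw' (Subtype.ext h).symm

/-- `semilocalUnits v u` is `1` at the finite places not above `v`. [cite: TateThesis1967, §3.2] -/
theorem semilocalUnits_snd_apply_of_not_over (u : (LocalRing E v)ˣ) {q : HeightOneSpectrum (𝓞 E)}
    (hq : q.under (𝓞 F) ≠ v) : ((semilocalUnits E v u : ideleGroup E) : AdeleRing (𝓞 E) E).2 q = 1 := by
  rw [← ideleGroup.finComp_apply, semilocalUnits_apply, map_prod]
  refine Finset.prod_eq_one fun w _ => ?_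
  rw [ideleGroup.finComp_apply]
  exact localUnits_snd_apply_of_ne _ fun h => hq (h ▸ w.2)

/-- The block inclusion is injective (read off the components above `v`). [cite: TateThesis1967, §3.2] -/
theorem semilocalUnits_injective : Function.Injective (semilocalUnits E v) := fun u u' h => by
  refine Units.ext (funext fun w => ?_)
  rw [← semilocalUnits_snd_apply_of_over E u w, ← semilocalUnits_snd_apply_of_over E u' w, h]

/-- The block inclusion is continuous (each ★ `localUnits w` is, ★ `continuous_localUnits`; units of a product ≃ product
of units, Mathlib `ContinuousMulEquiv.piUnits`). [cite: TateThesis1967, §3.2] -/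
theorem continuous_semilocalUnits : Continuous (semilocalUnits E v) := by
  refine continuous_finsetProd _ fun w _ => (continuous_localUnits w.1).comp ?_
  exact (continuous_apply w).comp
    (ContinuousMulEquiv.piUnits (M := fun w : PlacesOver E v => w.1.adicCompletion E)).continuous

/-- **`Gal(E/F)`-equivariance of the block inclusion**: `σ • semilocalUnits v u = semilocalUnits v ((σ ⊗ 1) u)`, where
`σ ⊗ 1 = conjLocal E σ v` acts on `∏_{w ∣ v} E_w` by `((σ ⊗ 1) u)_w = σ_w (u_{σ⁻¹ w})` — both sides have component
`σ (u_{σ⁻¹ w})` at `w ∣ v` (★ `IdeleHerbrand.snd_smul_apply`, ★ `conjLocal_apply`) and `1` elsewhere.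
[cite: CasselsFrohlichANT1967, Ch. VII §1.1] -/
theorem smul_semilocalUnits (σ : E ≃ₐ[F] E) (u : (LocalRing E v)ˣ) :
    σ • semilocalUnits E v u = semilocalUnits E v (Units.map (conjLocal E σ v : LocalRing E v →* LocalRing E v) u) := by
  apply Units.ext
  refine Prod.ext ?_ (FiniteAdeleRing.ext E fun q => ?_)
  · rw [IdeleHerbrand.fst_smul, semilocalUnits_fst, semilocalUnits_fst, smul_one]
  · rw [IdeleHerbrand.snd_smul_apply]
    by_cases hq : q.under (𝓞 F) = v
    · have hq' : (σ⁻¹ • q).under (𝓞 F) = v := by rw [HeightOneSpectrum.under_algEquiv_smul]; exact hq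
      rw [semilocalUnits_snd_apply_of_over E u ⟨σ⁻¹ • q, hq'⟩,
        semilocalUnits_snd_apply_of_over E _ ⟨q, hq⟩, Units.coe_map]
      rfl
    · have hq' : (σ⁻¹ • q).under (𝓞 F) ≠ v := by rwa [HeightOneSpectrum.under_algEquiv_smul]
      rw [semilocalUnits_snd_apply_of_not_over E u hq', semilocalUnits_snd_apply_of_not_over E _ hq, map_one]

/-- **A semi-local unit maps into the adelic torus `T(𝔸_F) = {x ∈ 𝕀_E : x · (c • x) = 1}` iff it is norm-one**
(`(c ⊗ 1)(u) · u = 1`, i.e. `u ∈ T(F_v) = U(1)_{E/F}(F_v)`) — at EVERY finite place `v`, split or not (equivariance +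
injectivity of the block inclusion). [cite: PlatonovRapinchuk1994, §6.2] -/
theorem semilocalUnits_mem_torus_iff (u : (LocalRing E v)ˣ) :
    semilocalUnits E v u ∈ TorusDict.torus c ↔ u ∈ normOneUnits (conjLocal E c v) := by
  rw [TorusDict.mem_torus_iff, smul_semilocalUnits, ← map_mul, ← map_one (semilocalUnits E v),
    (semilocalUnits_injective E).eq_iff, mul_comm]
  rfl

/-- A norm-one semi-local unit maps into the adelic torus. [cite: PlatonovRapinchuk1994, §6.2] -/
theorem semilocalUnits_mem_torus {u : (LocalRing E v)ˣ} (hu : u ∈ normOneUnits (conjLocal E c v)) :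
    semilocalUnits E v u ∈ TorusDict.torus c :=
  (semilocalUnits_mem_torus_iff E c u).2 hu

/-! ## §2 Semi-local components of Hecke characters -/

variable (v) in
/-- **The semi-local component `χ_v : (E ⊗_F F_v)ˣ → ℂˣ` of a Hecke character `χ` of `E` at a finite place `v` of `F`**:
`χ ∘ semilocalUnits v` (the `μ`-slot `(∏_{w ∣ v} L_w)ˣ →* ℂˣ` of ★ `cmXiTorusChar`).  A deliberate dot-notation extension of
★ `GaloisRepresentations.HeckeCharacter` from this directory. [cite: TateThesis1967, §4.3] -/
def _root_.Literature.NumberTheory.GaloisRepresentations.HeckeCharacter.semilocalComponent (χ : HeckeCharacter E) :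
    (LocalRing E v)ˣ →* ℂˣ :=
  χ.toContinuousMonoidHom.toMonoidHom.comp (semilocalUnits E v)

/-- Unfolding `semilocalComponent`. [cite: TateThesis1967, §4.3] -/
@[simp] theorem semilocalComponent_apply (χ : HeckeCharacter E) (u : (LocalRing E v)ˣ) :
    χ.semilocalComponent E v u = χ (semilocalUnits E v u) := rfl

/-- **`χ_v (u) = ∏_{w ∣ v} χ_w (u_w)`**: the semi-local component is the product of the local components ★
`HeckeCharacter.localComponent` at the places above `v`. [cite: TateThesis1967, §4.3] -/
theorem semilocalComponent_eq_prod (χ : HeckeCharacter E) (u : (LocalRing E v)ˣ) :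
    χ.semilocalComponent E v u = ∏ w : PlacesOver E v, χ.localComponent w.1 (MulEquiv.piUnits u w) := by
  rw [semilocalComponent_apply, semilocalUnits_apply]
  change χ.toContinuousMonoidHom.toMonoidHom (∏ w : PlacesOver E v, localUnits w.1 (MulEquiv.piUnits u w)) = _
  rw [map_prod]
  rfl

/-- **The one-factor reading at a NON-SPLIT place**: if `w ∣ v` is fixed by `c` (`c ≠ 1`, `[E : F] = 2`; then `w` is the only
place above `v`, ★ `PlacesOver.subsingleton_of_smul_eq`), `χ_v (u) = χ_w (u_w)`. [cite: CasselsFrohlichANT1967, Ch. VII Prop. 1.2 (ii)] -/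
theorem semilocalComponent_eq_localComponent_of_smul_eq [Algebra.IsQuadraticExtension F E] (hc : c ≠ 1)
    (w : PlacesOver E v) (hw : c • w.1 = w.1) (χ : HeckeCharacter E) (u : (LocalRing E v)ˣ) :
    χ.semilocalComponent E v u = χ.localComponent w.1 (MulEquiv.piUnits u w) := by
  rw [semilocalComponent_eq_prod, PlacesOver.prod_eq_of_smul_eq c hc w hw]

/-- The semi-local component is continuous. [cite: TateThesis1967, §4.3] -/
theorem continuous_semilocalComponent (χ : HeckeCharacter E) : Continuous (χ.semilocalComponent E v) :=
  χ.toContinuousMonoidHom.continuous.comp (continuous_semilocalUnits E)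

/-! ## §3 The local torus inside the adelic torus: `T(F_v) →* T(𝔸_F)` -/

variable (v) in
/-- **The inclusion `T(F_v) = U(1)_{E/F}(F_v) ↪ T(𝔸_F)`** of the local norm-one torus (`normOneUnits (conjLocal E c v)`, the
elements `u ∈ (∏_{w ∣ v} E_w)ˣ` with `(c ⊗ 1)(u) · u = 1`) into the adelic torus ★ `TorusDict.torus c`, supported above `v`
(the restriction of `semilocalUnits v`). [cite: PlatonovRapinchuk1994, §6.2] -/
def locTorusIncl : ↥(normOneUnits (conjLocal E c v)) →* ↥(TorusDict.torus c) :=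
  ((semilocalUnits E v).comp (normOneUnits (conjLocal E c v)).subtype).codRestrict _ fun t =>
    semilocalUnits_mem_torus E c t.2

/-- Underlying idele of `locTorusIncl v t`. [cite: PlatonovRapinchuk1994, §6.2] -/
@[simp] theorem coe_locTorusIncl (t : ↥(normOneUnits (conjLocal E c v))) :
    ((locTorusIncl E c v t : TorusDict.torus c) : ideleGroup E) = semilocalUnits E v (t : (LocalRing E v)ˣ) := rfl

/-- `locTorusIncl v` is injective. [cite: PlatonovRapinchuk1994, §6.2] -/
theorem locTorusIncl_injective : Function.Injective (locTorusIncl E c v) := fun _ _ h =>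
  Subtype.ext (semilocalUnits_injective E (congrArg (fun x : TorusDict.torus c => (x : ideleGroup E)) h))

/-- `locTorusIncl v` is continuous. [cite: PlatonovRapinchuk1994, §6.2] -/
theorem continuous_locTorusIncl : Continuous (locTorusIncl E c v) :=
  ((continuous_semilocalUnits E).comp continuous_subtype_val).subtype_mk _

/-- **At a NON-SPLIT place the local torus is integral**: if every place of `E` above `v` is fixed by `c`, then
`locTorusIncl v t ∈ T(𝒪_v) := T(𝔸_F) ∩ ∏_{w ∣ v} 𝒪_w^×` (★ `IdeleHerbrand.localUnitIdeles F E v`) for EVERY `t ∈ T(F_v)` — the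
local torus at a non-split place is compact, `T(F_v) = T(𝒪_v)` (★ `TorusDict.mem_localUnitIdeles_of_mem_torus`).
[cite: Arthur2011Draft, d-p.310] -/
theorem locTorusIncl_mem_localUnitIdeles_of_smul_eq (hv : ∀ w : PlacesOver E v, c • w.1 = w.1)
    (t : ↥(normOneUnits (conjLocal E c v))) :
    ((locTorusIncl E c v t : TorusDict.torus c) : ideleGroup E) ∈ IdeleHerbrand.localUnitIdeles F E v :=
  TorusDict.mem_localUnitIdeles_of_mem_torus c (locTorusIncl E c v t).2 (semilocalUnits_fst E _)
    (fun _ hq => semilocalUnits_snd_apply_of_not_over E _ hq) fun w hw => hv ⟨w, hw⟩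

/-! ## §4 Local components `ξ_v : T(F_v) → ℂˣ` of characters of `T(𝔸_F)` -/

variable (v) in
/-- **The local component `ξ_v := ξ ∘ (T(F_v) ↪ T(𝔸_F))` at the finite place `v`** of a character `ξ = ψ` of the adelic
norm-one torus `T(𝔸_F)` — a character of `T(F_v) = normOneUnits (conjLocal E c v)`, the type of the labels `η₁, η₂` of ★
`cmXiTorusChar` ∕ `Rogawski1990.KeysCaseTwoLabels` («`ξ_v`, the component of the character `ξ` of `C_1`»).
[cite: Rogawski1990, §12.2 pp. 173–174] -/
def torusLocalComponent (ψ : ↥(TorusDict.torus c) →ₜ* ℂˣ) : ↥(normOneUnits (conjLocal E c v)) →* ℂˣ :=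
  ψ.toMonoidHom.comp (locTorusIncl E c v)

/-- Unfolding `torusLocalComponent`. [cite: Rogawski1990, §12.2 pp. 173–174] -/
@[simp] theorem torusLocalComponent_apply (ψ : ↥(TorusDict.torus c) →ₜ* ℂˣ) (t : ↥(normOneUnits (conjLocal E c v))) :
    torusLocalComponent E c v ψ t = ψ (locTorusIncl E c v t) := rfl

/-- `ξ_v` is continuous, in the `ℂ`-valued form the packet vocabulary consumes. [cite: Rogawski1990, §12.2 pp. 173–174] -/
theorem continuous_torusLocalComponent (ψ : ↥(TorusDict.torus c) →ₜ* ℂˣ) :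
    Continuous fun t => ((torusLocalComponent E c v ψ t : ℂˣ) : ℂ) :=
  Units.continuous_val.comp (ψ.continuous.comp (continuous_locTorusIncl E c))

/-- **`ξ_v` is unitary for automorphic `ξ`** (`[E : F] = 2`, `c ≠ 1`): `‖ξ_v (t)‖ = 1` (★
`norm_torusHom_apply_eq_one_of_isAutomorphic`: automorphic characters of the anisotropic torus are unitary).
[cite: PlatonovRapinchuk1994, §6.2] -/
theorem norm_torusLocalComponent_eq_one (h2 : Module.finrank F E = 2) (hc : c ≠ 1)
    (ψ : ↥(TorusDict.torus c) →ₜ* ℂˣ) (hψ : TorusDict.IsAutomorphic c ψ) (t : ↥(normOneUnits (conjLocal E c v))) :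
    ‖((torusLocalComponent E c v ψ t : ℂˣ) : ℂ)‖ = 1 :=
  norm_torusHom_apply_eq_one_of_isAutomorphic F E c h2 hc ψ hψ _

/-- **Spherical at a non-split place ⇒ `ξ_v = 1`**: if every place above `v` is fixed by `c` and `ψ` is trivial on
`T(𝒪_v) = T(𝔸_F) ∩ ∏_{w ∣ v} 𝒪_w^×` (« spherical at `v` »), then `ξ_v` is trivial — at a non-split place `T(F_v) = T(𝒪_v)`.
[cite: Arthur2011Draft, d-p.310] -/
theorem torusLocalComponent_eq_one_of_spherical (hv : ∀ w : PlacesOver E v, c • w.1 = w.1)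
    (ψ : ↥(TorusDict.torus c) →ₜ* ℂˣ)
    (hsph : ∀ t : TorusDict.torus c, (t : ideleGroup E) ∈ IdeleHerbrand.localUnitIdeles F E v → ψ t = 1)
    (t : ↥(normOneUnits (conjLocal E c v))) : torusLocalComponent E c v ψ t = 1 :=
  hsph _ (locTorusIncl_mem_localUnitIdeles_of_smul_eq E c hv t)

/-! ## §5 The local dictionary `χ̃ = ψ ∘ (z ↦ c • z / z)` at `v`, and the split-place convention -/

/-- The twisted semi-local unit `(c ⊗ 1)(u) / u` is norm-one (`[E : F] = 2`, `c ≠ 1`): its idele is the Hilbert-90 twist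
`c • z / z` of `z = semilocalUnits v u`, which lies in the torus (★ `TorusDict.twist_mem_torus`). [cite: CasselsFrohlichANT1967, Ch. VII (Tate) §7.4] -/
theorem map_div_self_mem_normOneUnits (h2 : Module.finrank F E = 2) (hc : c ≠ 1) (u : (LocalRing E v)ˣ) :
    Units.map (conjLocal E c v : LocalRing E v →* LocalRing E v) u / u ∈ normOneUnits (conjLocal E c v) := by
  rw [← semilocalUnits_mem_torus_iff, map_div, ← smul_semilocalUnits, ← Herbrand.twist_apply]
  exact TorusDict.twist_mem_torus c h2 hc _

/-- **The local dictionary at `v`** (`[E : F] = 2`, `c ≠ 1`): for an automorphic character `ψ` of `T(𝔸_F)` with base change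
`χ̃ = TorusDict.pullback ψ` (`χ̃ (z) = ψ (c • z / z)`), the semi-local component of `χ̃` at `v` is `ξ_v` evaluated at the
twisted unit: `χ̃_v (u) = ξ_v ((c ⊗ 1)(u) / u)`. [cite: Rogawski1990, §12.1 p. 172] -/
theorem pullback_semilocalComponent (h2 : Module.finrank F E = 2) (hc : c ≠ 1)
    (ψ : ↥(TorusDict.torus c) →ₜ* ℂˣ) (hψ : TorusDict.IsAutomorphic c ψ) (u : (LocalRing E v)ˣ) :
    (TorusDict.pullback c h2 hc ψ hψ).semilocalComponent E v u =
      torusLocalComponent E c v ψ ⟨_, map_div_self_mem_normOneUnits E c h2 hc u⟩ := by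
  rw [semilocalComponent_apply, TorusDict.pullback_apply, torusLocalComponent_apply]
  congr 1
  refine Subtype.ext ?_
  rw [TorusDict.coe_twistToTorus_apply, Herbrand.twist_apply, coe_locTorusIncl, smul_semilocalUnits, ← map_div]

/-- **The split-place convention lemma** (D6 design, junk point (J6)): for the base change `χ̃ = TorusDict.pullback ψ` of an
automorphic character `ψ` of `T(𝔸_F)`, the local components at the two places `w`, `c • w` above a split `v` are mutually
INVERSE-CONJUGATE — `χ̃_{c • w} (c_w a) = χ̃_w (a)⁻¹` for `a ∈ E_wˣ`, `c_w : E_w ≃ E_{c • w}` the Galois transport (★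
`galAdicCompletionUnitsEquiv`).  From ★ `algEquiv_smul_localUnits` (`c • ⟨a⟩_w = ⟨c_w a⟩_{c • w}`) and ★ `TorusDict.pullback_smul`
(`χ̃ (c • z) = χ̃ (z)⁻¹`); valid at every finite `w` (at a `c`-fixed `w` it says `χ̃_w ∘ c_w = χ̃_w⁻¹`). [cite: Rogawski1990, §12.2 pp. 173–174] -/
theorem pullback_localComponent_smul (h2 : Module.finrank F E = 2) (hc : c ≠ 1)
    (ψ : ↥(TorusDict.torus c) →ₜ* ℂˣ) (hψ : TorusDict.IsAutomorphic c ψ) (w : HeightOneSpectrum (𝓞 E))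
    (a : (w.adicCompletion E)ˣ) :
    (TorusDict.pullback c h2 hc ψ hψ).localComponent (c • w) (galAdicCompletionUnitsEquiv (L := E) c rfl a) =
      ((TorusDict.pullback c h2 hc ψ hψ).localComponent w a)⁻¹ := by
  rw [HeckeCharacter.localComponent_apply, HeckeCharacter.localComponent_apply, ← algEquiv_smul_localUnits,
    TorusDict.pullback_smul]

omit [NumberField F] in
/-- The same convention for ANY conjugate-inverse Hecke character (`χ (c • z) = χ (z)⁻¹`, e.g. every base change from `T`):
`χ_{c • w} (c_w a) = χ_w (a)⁻¹`. [cite: CasselsFrohlichANT1967, Ch. VII §1.1] -/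
theorem localComponent_smul_of_conjInverse (χ : HeckeCharacter E) (hχ : ∀ z : ideleGroup E, χ (c • z) = (χ z)⁻¹)
    (w : HeightOneSpectrum (𝓞 E)) (a : (w.adicCompletion E)ˣ) :
    χ.localComponent (c • w) (galAdicCompletionUnitsEquiv (L := E) c rfl a) = (χ.localComponent w a)⁻¹ := by
  rw [HeckeCharacter.localComponent_apply, HeckeCharacter.localComponent_apply, ← algEquiv_smul_localUnits, hχ]

/-- **The base change of an automorphic torus character is unitary**: `‖χ̃ (z)‖ = 1` for `χ̃ = TorusDict.pullback ψ`, `ψ`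
automorphic (`χ̃ (z) = ψ (c • z / z)` and ★ `norm_torusHom_apply_eq_one_of_isAutomorphic`). [cite: PlatonovRapinchuk1994, §6.2] -/
theorem norm_pullback_apply_eq_one (h2 : Module.finrank F E = 2) (hc : c ≠ 1)
    (ψ : ↥(TorusDict.torus c) →ₜ* ℂˣ) (hψ : TorusDict.IsAutomorphic c ψ) (z : ideleGroup E) :
    ‖((TorusDict.pullback c h2 hc ψ hψ z : ℂˣ) : ℂ)‖ = 1 := by
  rw [TorusDict.pullback_apply]
  exact norm_torusHom_apply_eq_one_of_isAutomorphic F E c h2 hc ψ hψ _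

/-- In particular every local component `χ̃_w` of the base change is unitary — the `‖ν₀ x‖ = 1` ∕ `‖χ′ x‖ = 1` hypotheses of the
split packet ★ `Rogawski1990.cmSplitPacket` when its labels are read off `χ̃.localComponent w`. [cite: PlatonovRapinchuk1994, §6.2] -/
theorem norm_pullback_localComponent_eq_one (h2 : Module.finrank F E = 2) (hc : c ≠ 1)
    (ψ : ↥(TorusDict.torus c) →ₜ* ℂˣ) (hψ : TorusDict.IsAutomorphic c ψ) (w : HeightOneSpectrum (𝓞 E))
    (a : (w.adicCompletion E)ˣ) :
    ‖(((TorusDict.pullback c h2 hc ψ hψ).localComponent w a : ℂˣ) : ℂ)‖ = 1 := by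
  rw [HeckeCharacter.localComponent_apply]
  exact norm_pullback_apply_eq_one E c h2 hc ψ hψ _

/-- And the semi-local component `χ̃_v` of the base change is unitary. [cite: PlatonovRapinchuk1994, §6.2] -/
theorem norm_pullback_semilocalComponent_eq_one (h2 : Module.finrank F E = 2) (hc : c ≠ 1)
    (ψ : ↥(TorusDict.torus c) →ₜ* ℂˣ) (hψ : TorusDict.IsAutomorphic c ψ) (u : (LocalRing E v)ˣ) :
    ‖(((TorusDict.pullback c h2 hc ψ hψ).semilocalComponent E v u : ℂˣ) : ℂ)‖ = 1 := by
  rw [semilocalComponent_apply]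
  exact norm_pullback_apply_eq_one E c h2 hc ψ hψ _

end Quadratic

/-! ## §6 The CM case `E = L`, `F = L⁺`, `c` = complex conjugation -/

section CM

variable (L : Type) [Field L] [NumberField L] [IsCMField L] {v : HeightOneSpectrum (𝓞 ↥(maximalRealSubfield L))}

/-- **CM local dictionary in Rogawski's convention `χ̃(a) = χ(a/ā)`**: for an automorphic character `ψ` of
`T(𝔸_{L⁺}) = U(1)_{L/L⁺}(𝔸_{L⁺})` with base change `χ̃ = TorusDict.pullback ψ` and `u ∈ (L ⊗ L⁺_v)ˣ`,
`χ̃_v (u) = ξ_v (u / ū)⁻¹`, `u / ū = quotConj u ∈ T(L⁺_v)` (★ `quotConj`, ★ `conjLocal_conjLocal_cm`).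
[cite: Rogawski1990, §12.1 p. 172] -/
theorem cm_pullback_semilocalComponent
    (ψ : ↥(TorusDict.torus (IsCMField.complexConj L)) →ₜ* ℂˣ) (hψ : TorusDict.IsAutomorphic (IsCMField.complexConj L) ψ)
    (u : (LocalRing L v)ˣ) :
    (TorusDict.pullback (IsCMField.complexConj L) (Algebra.IsQuadraticExtension.finrank_eq_two _ L)
        (IsCMField.complexConj_ne_one (K := L)) ψ hψ).semilocalComponent L v u =
      (torusLocalComponent L (IsCMField.complexConj L) v ψ
        (quotConj (conjLocal L (IsCMField.complexConj L) v) (conjLocal_conjLocal_cm L v) u))⁻¹ := by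
  rw [pullback_semilocalComponent L (IsCMField.complexConj L) _ (IsCMField.complexConj_ne_one (K := L)) ψ hψ u, ← map_inv]
  congr 1

/-- **`ξ_v` is unitary** for an automorphic character `ξ = ψ` of `U(1)_{L/L⁺}(𝔸_{L⁺})` (CM form of
`norm_torusLocalComponent_eq_one`). [cite: PlatonovRapinchuk1994, §6.2] -/
theorem cm_norm_torusLocalComponent_eq_one
    (ψ : ↥(TorusDict.torus (IsCMField.complexConj L)) →ₜ* ℂˣ) (hψ : TorusDict.IsAutomorphic (IsCMField.complexConj L) ψ)
    (t : ↥(normOneUnits (conjLocal L (IsCMField.complexConj L) v))) :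
    ‖((torusLocalComponent L (IsCMField.complexConj L) v ψ t : ℂˣ) : ℂ)‖ = 1 :=
  norm_torusLocalComponent_eq_one L (IsCMField.complexConj L) (Algebra.IsQuadraticExtension.finrank_eq_two _ L)
    (IsCMField.complexConj_ne_one (K := L)) ψ hψ t

/-- **CM split-place convention**: `χ̃_{w̄} (ā) = χ̃_w (a)⁻¹` for the base change `χ̃` of an automorphic character of
`U(1)_{L/L⁺}(𝔸_{L⁺})`, `w̄ = c • w`, `ā = c_w a`. [cite: Rogawski1990, §12.2 pp. 173–174] -/
theorem cm_pullback_localComponent_smul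
    (ψ : ↥(TorusDict.torus (IsCMField.complexConj L)) →ₜ* ℂˣ) (hψ : TorusDict.IsAutomorphic (IsCMField.complexConj L) ψ)
    (w : HeightOneSpectrum (𝓞 L)) (a : (w.adicCompletion L)ˣ) :
    (TorusDict.pullback (IsCMField.complexConj L) (Algebra.IsQuadraticExtension.finrank_eq_two _ L)
        (IsCMField.complexConj_ne_one (K := L)) ψ hψ).localComponent (IsCMField.complexConj L • w)
        (galAdicCompletionUnitsEquiv (L := L) (IsCMField.complexConj L) rfl a) =
      ((TorusDict.pullback (IsCMField.complexConj L) (Algebra.IsQuadraticExtension.finrank_eq_two _ L)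
        (IsCMField.complexConj_ne_one (K := L)) ψ hψ).localComponent w a)⁻¹ :=
  pullback_localComponent_smul L (IsCMField.complexConj L) _ _ ψ hψ w a

end CM

end UnitaryGroup

end Literature.NumberTheory.Automorphic

end
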